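import Literature.AnabelianGeometry.EtaleTheta.SettingModelChiThetaCocycle
import Literature.AnabelianGeometry.EtaleTheta.SettingModelChiMuTwoInversionCusp
import Literature.AnabelianGeometry.EtaleTheta.Discharge.Sec1Def17Coverings
import Literature.AnabelianGeometry.EtaleTheta.Discharge.Sec1CompatHolds
import Literature.AnabelianGeometry.EtaleTheta.ContH1ConjAction
import HarnessLib

/-!
# [EtTh] Rmk 1.9.1 at the χ-twisted model: `ε_μ` FIXES the model's theta class `η̈^Θ = etaDdχ` (it does not
# negate it) — the stabiliser of `etaDdχ` meets `Π^tp_X ∖ Π^tp_Ẋ` (proof-only; junction question (Q) answered YES)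

Mochizuki, *The Étale Theta Function …* [EtTh], Publ. RIMS 45 (2009), §1, Rmk 1.9.1, PRIMS PDF p.29 ("any inner
automorphism of `Π^tp_{Ċ}` maps `η̈^{Θ,ℤ} ↦ η̈^{Θ,ℤ}`, while `ε_μ`, `ε_±` map `η̈^{Θ,ℤ} ↦ −η̈^{Θ,ℤ}`"), Def 1.7 p.27
(`ε_μ ∈ Gal(Ẍ/X)`, `Π^tp_Ẋ`), §2 Cor 2.8 (iii) p.42 (bib key `MochizukiEtTh2009`).

PROOF-ONLY companion (no `def`, no instance, no new `Prop`; cell abc-iut, layer L2, seat abc-iut-w6-d049 gen 4; the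
KERNEL CHECK of the junction question (Q) posed with `Discharge/Sec2OuterPC5Reduction` p455742, routed by abc-iut-L2-lead
R526 to the (closed) seat abc-iut-w6-d083 and taken by this seat 17:10Z).  (Q) asked whether the stabiliser of the χ-model's
theta class `η̈^Θ := etaDdχ p` (abc-iut-L2-d1, `SettingModelChiThetaCocycle`) under `Π^tp_X`-conjugation contains an
element OUTSIDE `Π^tp_Ẋ = inclX⁻¹(dotX ε_Z)` — equivalently, whether the model is «sign-blind» for `η̈^Θ` where print
(Rmk 1.9.1) has `ε_μ : η̈^{Θ,ℤ} ↦ −η̈^{Θ,ℤ}`.  ANSWER: YES.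
* §1 `MuTwoSetting.epsMu_not_mem_dotX` — GENERIC over any `MuTwoSetting` (Def 1.7 interface): for an admissible `ε_Z`
  the representative `ε_μ` is NOT in `Π^tp_Ẋ = Π^tp_Ẍ·⟨ε_Z⟩` (`ε_μ ∉ Π^tp_Ẍ`, `ε_Z·ε_μ⁻¹ ∉ Π^tp_Ẍ`);
* §2 `levelHom_z_conj_b` — on the Heisenberg levels of `Γ` the conjugate `b⁻¹·γ·θ_σ(b)` of a degree-`0` element `γ`
  (`x = 0`) by the loop `b` has the SAME `z`-coordinate (`b`, `γ`, `θ_σ(b) = (0, χ_N σ, 0)` all lie in the abelian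
  plane `x = 0`);
* §3 **`conj_inl_b_etaDdχ`** — `ContH1.conj (inl b) (etaDdχ p) = etaDdχ p`: conjugation by `ε_μ = inl b` FIXES the model's
  `η̈^Θ`, already pointwise on abc-iut-L2-d1's cocycle `g ↦ θ(inl(centreRep g.left))` (§2 for the argument; the value is
  central, abc-iut-L2-d1's `conj_toTheta_inl_centreRep` with trivial Galois part, for the coefficient);
* §4 **`exists_not_mem_dotX_conj_etaDdχ_eq`** (at `MuTwoSetting.inversionModelχ′`, the χ′ site of abc-iut-L2-t10's
  `OrbitEmbedding` instance p454259; twin `…_inversionModelχ`): `∃ s : Π^tp_X, inclX s ∉ dotX ε_Z ∧ conj s η̈^Θ = η̈^Θ`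
  with `s := inl b` = the `ε_μ` of the model.
CONSEQUENCE for the OUTER chain of Cor 2.8 (iii) (p455742): at the χ′ site the dotted-membership junction
«`σ₀ ∈ Π^tp_{Ẋ̲̲}`» of P-C5 is NOT obstructed by parity — abc-iut-w6-d083's `σ_{ε_±} = 1` (p443069) can be corrected by
the stabiliser element `inl b ∉ Π^tp_Ẋ`; the remaining junction clause is constructor-internal («`ε_± ∈ T.tp T.PiCu`» for
abc-iut-L2-d3's `temperedCoverDataOfHuuOfSection`, i.e. the chosen inversion `ι₀` lies in `ιC(ε_±)·Π_{X̲}` — true inside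
the proof of `exists_inversion_ofHuuOfSection` (`c⁻¹·ι₀ ∈ Xu`) but not exported by its `∃`-statement).
MODEL-FAITHFULNESS LABEL (on OUR semi-synthetic model, not on [EtTh]): Rmk 1.9.1's second clause «`ε_μ ↦ −η̈^{Θ,ℤ}`» is
NOT reproduced by `etaDdχ` (it IS for `log(Ü)`: abc-iut-w5-d140's `Sec1DeckNegatesCoordModelChi`, p447647).  HONEST
FRAMING: [EtTh] is refereed; nothing of it is asserted; consistency evidence only; no side is taken on [IUTchIII] Cor 3.12;
typed ≠ proved.
-/

noncomputable section

namespace Literature.AnabelianGeometry.EtaleTheta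

open Literature.AnabelianGeometry.SemiGraphs _root_.Function

/-! ## §1. `ε_μ ∉ Π^tp_Ẋ` for an admissible `ε_Z` (generic Def 1.7 bookkeeping) -/

namespace MuTwoSetting

variable {p : ℕ} [Fact p.Prime] (M : MuTwoSetting p)

/-- **`ε_μ ∉ Π^tp_Ẋ`**: for an admissible `ε_Z` (`ε_Z ∉ Π^tp_Ẍ`, `ε_Z·ε_μ⁻¹ ∉ Π^tp_Ẍ`) the representative `ε_μ` of
Def 1.7 does not lie in `Π^tp_Ẋ = Π^tp_Ẍ ∪ Π^tp_Ẍ·ε_Z` (`ε_μ ∉ Π^tp_Ẍ` is the field `epsMu_not_mem`).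
[cite: MochizukiEtTh2009, Def 1.7 p.27] -/
theorem epsMu_not_mem_dotX {εZ : M.GtpC} (hZ : M.IsAdmissibleEpsZ εZ) : M.epsMu ∉ M.dotX εZ := by
  rw [M.mem_dotX_iff]
  rintro (h | h)
  · exact M.epsMu_not_mem h
  · refine hZ.2.2 ?_
    have h' := Subgroup.inv_mem _ h
    rwa [mul_inv_rev, inv_inv] at h'

end MuTwoSetting

namespace SettingModel

variable (p : ℕ) [Fact p.Prime]

/-! ## §2. Levels: conjugating a degree-`0` element of `Γ` by the loop `b` keeps its `z`-coordinate -/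

/-- On `Heis(ℤ/N)`: for `γ ∈ Ker pr₂` (level `x = 0`) and any `σ ∈ G_{ℚ_p}`, the element `b⁻¹·γ·θ_σ(b)` has the same
`z`-level as `γ` — the levels of `b`, `γ`, `θ_σ(b) = (0, χ_N(σ), 0)` lie in the abelian plane `x = 0` of the
Heisenberg group, where `z` is additive. [cite: MochizukiEtTh2009, §1 p.12] -/
theorem levelHom_z_conj_b (N : ℕ+) (σ : GQp p) {γ : Gfp} (hγ : γ ∈ gfpSnd.ker) :
    (levelHom N ((gfpOf (FreeGroup.of 1))⁻¹ * γ * actχ p σ (gfpOf (FreeGroup.of 1)))).z = (levelHom N γ).z := by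
  have hx := levelHom_x_eq_zero (N := N) hγ
  rw [map_mul, map_mul, map_inv, (chiTwistData p).hlev, chiTwistData_δ, levelHom_gfpOf, heisHom_of_one]
  simp [Heis.map_apply, hx]

/-- `b⁻¹·γ·θ_σ(b) ∈ Ker pr₂` for `γ ∈ Ker pr₂` (`b` has degree `0`, the twist preserves the degree).
[cite: MochizukiEtTh2009, §1 p.12] -/
theorem conj_b_mem_ker (σ : GQp p) {γ : Gfp} (hγ : γ ∈ gfpSnd.ker) :
    (gfpOf (FreeGroup.of 1))⁻¹ * γ * actχ p σ (gfpOf (FreeGroup.of 1)) ∈ gfpSnd.ker := by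
  have hb : gfpSnd (gfpOf (FreeGroup.of 1)) = 1 := by
    rw [gfpSnd_gfpOf]
    change Heis.xHom (heisHom (FreeGroup.of 1)) = 1
    rw [heisHom_of_one]
    rfl
  rw [MonoidHom.mem_ker, map_mul, map_mul, map_inv, (chiTwistData p).hdeg, hb, MonoidHom.mem_ker.1 hγ, inv_one,
    one_mul, one_mul]

/-! ## §3. `ε_μ = inl b` FIXES the model's theta class -/

/-- **Conjugation by `ε_μ = inl b` FIXES `η̈^Θ = etaDdχ`** — pointwise on abc-iut-L2-d1's cocycle: its argument
`(inl b)⁻¹·g·(inl b)` has `Γ`-part `b⁻¹·g.left·θ_{g.right}(b)` with the same `z`-levels as `g.left` (§2), so the same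
value `θ(inl(centreRep ·))`; and that value is central, so the coefficient conjugation by `θ(inl b)` is trivial
(abc-iut-L2-d1's `conj_toTheta_inl_centreRep` with trivial Galois part).  Print (Rmk 1.9.1) has `ε_μ : η̈^{Θ,ℤ} ↦ −η̈^{Θ,ℤ}`;
the χ-model's class is sign-blind. [cite: MochizukiEtTh2009, Rmk 1.9.1 p.29] -/
theorem conj_inl_b_etaDdχ :
    haveI := (ThetaSetting.modelχ p).compat.GtpYdd_normal
    ContH1.conj (ThetaSetting.modelχ p).toTheta (ThetaSetting.modelχ p).DeltaTheta
        (SemidirectProduct.inl (gfpOf (FreeGroup.of 1)) : PiTpχ p) (etaDdχ p) = etaDdχ p := by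
  haveI := (ThetaSetting.modelχ p).compat.GtpYdd_normal
  set b : Gfp := gfpOf (FreeGroup.of 1) with hb
  set β : PiTpχ p := SemidirectProduct.inl b with hβ
  rw [etaDdχ_eq_mk]
  change ContH1.conj _ _ _ (QuotientGroup.mk _) = QuotientGroup.mk _
  rw [ContH1.conj_mk]
  congr 1
  refine Subtype.ext (funext fun x => Subtype.ext ?_)
  rw [ContH1.conjCocycle_apply, MulAut.conjNormal_apply, coe_thetaCocycleFunχ, coe_thetaCocycleFunχ]
  have hxker : (x : PiTpχ p).left ∈ gfpSnd.ker :=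
    left_mem_ker_of_mem_GtpY ((ThetaSetting.modelχ p).GtpYdd_le_GtpY x.2)
  -- the argument of the conjugated cocycle
  have hx' : ((MulAut.conjNormal β⁻¹ x : ↥(ThetaSetting.modelχ p).GtpYdd) : PiTpχ p) = β⁻¹ * x * β := by
    rw [MulAut.conjNormal_apply, inv_inv]
  have hβinv : β⁻¹ = SemidirectProduct.inl b⁻¹ := by rw [hβ, map_inv]
  have hleft : (β⁻¹ * (x : PiTpχ p) * β).left = b⁻¹ * (x : PiTpχ p).left * actχ p (x : PiTpχ p).right b := by
    rw [hβinv, SemidirectProduct.mul_left, SemidirectProduct.mul_left, SemidirectProduct.mul_right,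
      SemidirectProduct.left_inl, SemidirectProduct.right_inl, SemidirectProduct.left_inl, map_one, MulAut.one_apply,
      one_mul]
  have hγ' : b⁻¹ * (x : PiTpχ p).left * actχ p (x : PiTpχ p).right b ∈ gfpSnd.ker := conj_b_mem_ker p _ hxker
  -- coefficient: `θ β` commutes with the (central) value; argument: same `z`-levels
  change CurveTheta.toTheta (curveχ p) β *
      CurveTheta.toTheta (curveχ p) (SemidirectProduct.inl (centreRep
        ((MulAut.conjNormal β⁻¹ x : ↥(ThetaSetting.modelχ p).GtpYdd) : PiTpχ p).left)) *
      (CurveTheta.toTheta (curveχ p) β)⁻¹ =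
    CurveTheta.toTheta (curveχ p) (SemidirectProduct.inl (centreRep (x : PiTpχ p).left))
  rw [hx', hleft, conj_toTheta_inl_centreRep p β hγ', hβ, SemidirectProduct.right_inl, map_one, MulAut.one_apply]
  refine toTheta_eq_of_right_eq_one p _ _ (SemidirectProduct.right_inl _) (SemidirectProduct.right_inl _) ?_
  rw [mem_closure_commutator₃_iff_forall_hHat]
  intro N
  rw [SemidirectProduct.left_inl, SemidirectProduct.left_inl, map_mul, map_inv]
  change levelHom N (centreRep (b⁻¹ * (x : PiTpχ p).left * actχ p (x : PiTpχ p).right b)) *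
      (levelHom N (centreRep (x : PiTpχ p).left))⁻¹ = 1
  rw [levelHom_centreRep N hγ', levelHom_centreRep N hxker, hb, levelHom_z_conj_b p N _ hxker, mul_inv_cancel]

/-- **The stabiliser of `etaDdχ` meets `Π^tp_X ∖ Π^tp_Ẍ`**: `ε_μ = inl b` fixes the class and is NOT in `Π^tp_Ẍ`
(parity `(0, 1)`, abc-iut-f-113's `inl_gfpOf_one_not_mem_Xddχ`). [cite: MochizukiEtTh2009, Rmk 1.9.1 p.29] -/
theorem exists_not_mem_Xddχ_conj_etaDdχ_eq :
    haveI := (ThetaSetting.modelχ p).compat.GtpYdd_normal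
    ∃ s : PiTpχ p, s ∉ Xddχ p ∧
      ContH1.conj (ThetaSetting.modelχ p).toTheta (ThetaSetting.modelχ p).DeltaTheta s (etaDdχ p) = etaDdχ p :=
  ⟨_, inl_gfpOf_one_not_mem_Xddχ p, conj_inl_b_etaDdχ p⟩

/-! ## §4. The junction question (Q) at the inversion models: answered YES -/

/-- **(Q) at `MuTwoSetting.inversionModelχ′`** (the χ′ site of the `OrbitEmbedding` instance, p454259): there is
`s ∈ Π^tp_X` with `inclX s ∉ Π^tp_Ẋ = dotX ε_Z` (the admissible `ε_Z := a` of the model) and `conj s η̈^Θ = η̈^Θ` for the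
model's theta class `η̈^Θ = etaDdχ` — namely `s := inl b`, the model's `ε_μ`.  So the χ′-model is SIGN-BLIND for `η̈^Θ`
where Rmk 1.9.1 prints `ε_μ : η̈^{Θ,ℤ} ↦ −η̈^{Θ,ℤ}` (a label on OUR model, not on [EtTh]).
[cite: MochizukiEtTh2009, Rmk 1.9.1 p.29] -/
theorem exists_not_mem_dotX_conj_etaDdχ_eq :
    haveI := (ThetaSetting.modelχ p).compat.GtpYdd_normal
    ∃ s : PiTpχ p, inclInvχ p s ∉ (MuTwoSetting.inversionModelχ' p).dotX (epsZInvχ p) ∧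
      ContH1.conj (ThetaSetting.modelχ p).toTheta (ThetaSetting.modelχ p).DeltaTheta s (etaDdχ p) = etaDdχ p :=
  ⟨SemidirectProduct.inl (gfpOf (FreeGroup.of 1)),
    (MuTwoSetting.inversionModelχ' p).epsMu_not_mem_dotX (MuTwoSetting.inversionModelχ'_isAdmissibleEpsZ p),
    conj_inl_b_etaDdχ p⟩

/-- The same at the cusp-free `MuTwoSetting.inversionModelχ` (same `Π^tp_C`, `inclX`, `ε_Z`, `ε_μ`).
[cite: MochizukiEtTh2009, Rmk 1.9.1 p.29] -/
theorem exists_not_mem_dotX_conj_etaDdχ_eq_inversionModelχ :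
    haveI := (ThetaSetting.modelχ p).compat.GtpYdd_normal
    ∃ s : PiTpχ p, inclInvχ p s ∉ (MuTwoSetting.inversionModelχ p).dotX (epsZInvχ p) ∧
      ContH1.conj (ThetaSetting.modelχ p).toTheta (ThetaSetting.modelχ p).DeltaTheta s (etaDdχ p) = etaDdχ p :=
  ⟨SemidirectProduct.inl (gfpOf (FreeGroup.of 1)),
    (MuTwoSetting.inversionModelχ p).epsMu_not_mem_dotX (MuTwoSetting.inversionModelχ_isAdmissibleEpsZ p),
    conj_inl_b_etaDdχ p⟩

end SettingModel

end Literature.AnabelianGeometry.EtaleTheta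

end
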